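import Mathlib
import Literature.Computability.Complexity.GraphEncodings
import Literature.Computability.Complexity.FoldCatBricks
import Literature.Computability.Complexity.UnaryOffsets
import Literature.Computability.Complexity.UnaryBricks
import Literature.Computability.Complexity.FPStringBricks
import Literature.Computability.Complexity.PlumbingBricks
import Literature.Computability.Complexity.Classes
import Literature.Computability.Complexity.SparseSetsUpwardSeparationNE
import Summits.PneNP.PneNP.Theorems.SymmetryBudgetWindowBarrierRankDict
import Summits.PneNP.PneNP.Theorems.SymmetryBudgetWindowBarrierExtractBricks

/-!
# Extraction bricks II for stub `stub_completeInvariantFP_of_canonicalForm` (line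
`canonical-form-completeness`, crux `SymmetryBudget.WindowBarrier`, item stmt-PneNP-2145)

Continuing `SymmetryBudgetWindowBarrierExtractBricks.lean` (parameters `unM/unG/unN`, attachment
vectors `attOf`, ranks `rankOf`/`rankPiece`, blocks `fixedFn`/`freeFn`):

* `coloursFn w = encList [encodeNat (rankOf w 0), …, encodeNat (rankOf w (g-1))]` — the items part of
  the colour list of the rank-coloured free graph;
* `lookupFn`, `dictFn w = encList [lookupOf w 0, …, lookupOf w (g-1)]` — the attachment DICTIONARY
  rank ↦ vector (`lookupFam` of `SymmetryBudgetWindowBarrierRankDict.lean`);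
* `extractFn w = ⟨⟨encodeNat g, freeFn w⟩, ⟨1ᵍ, coloursFn w⟩⟩` — the code of the rank-coloured free
  graph in the format `⟨encodingGraph-code, encodingFinVec-code⟩`, with the size bound
  `|extractFn w| ≤ (3 (⌊log₂ |w|⌋ + 1))²` on EVERY input (`length_extractFn_le`);
* `invFn can = ⟨⟨fixedFn, dictFn⟩, can ∘ extractFn⟩` and **`invFn_mem_FP`**: for
  `can ∈ FTIME (N ↦ 2^{c √N})` the whole map is in `FP` — the composition
  `TimeComputable.comp_holds` at the poly-logarithmic intermediate length, where
  `2^{c · 3 (log₂|w| + 1)} = 8^c |w|^{O(c)}` (`comp_mem_FP_of_FTIME_sqrt`, with `two_pow_mul_log_le` of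
  `SparseSetsUpwardSeparationNE.lean`).
-/

-- `Summit.PneNP.PneNP.…` duplicates `PneNP` BY DESIGN (single-problem summit).
set_option linter.dupNamespace false

namespace Summit.PneNP.PneNP.Theorems.CompleteInvariant

open Literature.Computability.Complexity Brick Plumb UnaryOffsets
open _root_.Computability Polynomial

/-! ### The colour list -/

/-- The colour piece: on `⟨w, 1ᵗ⟩`, the frame `⟨encodeNat (rankOf w t), ε⟩`. -/
noncomputable def colPiece : List Bool → List Bool := fanoutFn rankPiece (fun _ => [])

/-- `colPiece ∈ FP`. -/
theorem colPiece_mem_FP : colPiece ∈ FP := fanoutFn_mem_FP rankPiece_mem_FP (const_mem_FP _)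

/-- Value of `colPiece` on a pair. -/
@[simp] theorem colPiece_boolPair (w u : List Bool) :
    colPiece (boolPair w u) = boolPair (encodeNat (rankOf w u.length)) [] := by
  simp [colPiece]

/-- `|colPiece ⟨w, u⟩| ≤ 2 |unG w| + 2`. -/
theorem length_colPiece_boolPair_le (w u : List Bool) : (colPiece (boolPair w u)).length ≤ 2 * (unG w).length + 2 := by
  have h := length_rankPiece_boolPair_le w u
  rw [rankPiece_boolPair] at h
  rw [colPiece_boolPair, length_boolPair]
  simp only [List.length_nil, add_zero]
  omega

/-- **The colour list** `coloursFn w = encList [encodeNat (rankOf w t) | t < g]` (the items part of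
`(encodingFinVec encodingNatBool g).encode rank`). -/
noncomputable def coloursFn : List Bool → List Bool := foldCat (2 * X + 2) X colPiece ∘ fanoutFn id unG

/-- `coloursFn ∈ FP`. -/
theorem coloursFn_mem_FP : coloursFn ∈ FP :=
  comp_mem_FP (foldCat_mem_FP _ X colPiece_mem_FP) (fanoutFn_mem_FP (PolyTimeComputable.id _) unG_mem_FP)

/-- Value of `coloursFn` as a concatenation of frames. -/
theorem coloursFn_eq_ccat (w : List Bool) :
    coloursFn w = ccat (fun t => boolPair (encodeNat (rankOf w t)) []) (unG w).length := by
  have h := foldCat_apply (Q := 2 * X + 2) (p := X) (f := colPiece) (x := w) (u := unG w)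
    (by simpa using length_unG_le' w) (fun t _ => (length_colPiece_boolPair_le w _).trans (by
      have := length_unG_le' w
      simp only [eval_add, eval_mul, eval_ofNat, eval_X]; omega))
  simp only [coloursFn, Function.comp_apply, fanoutFn_apply, id, h]
  refine ccat_congr fun t _ => ?_
  rw [colPiece_boolPair]; simp [ones]

/-- **Value of `coloursFn` on every input.** -/
theorem coloursFn_apply (w : List Bool) :
    coloursFn w = encList ((List.range (unG w).length).map fun t => encodeNat (rankOf w t)) := by
  rw [coloursFn_eq_ccat, ccat_frame_eq_encList]

/-- `|coloursFn w| ≤ |unG w| (2 |unG w| + 2)`. -/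
theorem length_coloursFn_le (w : List Bool) :
    (coloursFn w).length ≤ (unG w).length * (2 * (unG w).length + 2) := by
  rw [coloursFn_eq_ccat]
  refine length_ccat_le' _ fun t _ => ?_
  rw [length_boolPair]
  have := (length_encodeNat_le_self (rankOf w t)).trans (rankOf_le w t)
  simp only [List.length_nil, add_zero]; omega

/-! ### The attachment dictionary -/

/-- The dictionary value at rank `r`: `lookupFam (attOf w) g n r` (`SymmetryBudgetWindowBarrierRankDict.lean`). -/
noncomputable def lookupOf (w : List Bool) (r : ℕ) : List Bool := lookupFam (attOf w) (unG w).length (unN w).length r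

/-- `|lookupOf w r| ≤ |unN w|`. -/
theorem length_lookupOf_le (w : List Bool) (r : ℕ) : (lookupOf w r).length ≤ (unN w).length := by
  unfold lookupOf lookupFam; exact List.length_take_le _ _

/-- The selection piece of the dictionary loop: on `⟨⟨w, 1ʳ⟩, 1ʲ⟩`, `attOf w j` if `rankOf w j = r`,
else `ε` (the rank is compared as a canonical numeral with `encodeNat r = lenBinF 1ʳ`). -/
noncomputable def selPiece : List Bool → List Bool :=
  iteFn (eqPairFn ∘ fanoutFn (rankPiece ∘ inner) (lenBinF ∘ sndF ∘ fstF)) (attPiece ∘ inner) (fun _ => [])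

/-- `selPiece ∈ FP`. -/
theorem selPiece_mem_FP : selPiece ∈ FP :=
  iteFn_mem_FP (comp_mem_FP eqPairFn_mem_FP (fanoutFn_mem_FP (comp_mem_FP rankPiece_mem_FP inner_mem_FP)
    (comp_mem_FP lenBinF_mem_FP (comp_mem_FP sndF_mem_FP fstF_mem_FP))))
    (comp_mem_FP attPiece_mem_FP inner_mem_FP) (const_mem_FP _)

/-- Value of `selPiece` on a record. -/
theorem selPiece_apply (w u v : List Bool) :
    selPiece (boolPair (boolPair w u) v) = if rankOf w v.length = u.length then attOf w v.length else [] := by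
  unfold selPiece
  have hc : (eqPairFn ∘ fanoutFn (rankPiece ∘ inner) (lenBinF ∘ sndF ∘ fstF)) (boolPair (boolPair w u) v) =
      [decide (rankOf w v.length = u.length)] := by
    simp only [Function.comp_apply, fanoutFn_apply, inner_apply, rankPiece_boolPair, fstF_boolPair,
      sndF_boolPair, lenBinF_apply, eqPairFn_boolPair]
    congr 1
    refine Bool.decide_congr ⟨fun h => by simpa using congrArg decodeNat h, fun h => by rw [h]⟩
  rw [iteFn_apply hc]
  by_cases h : rankOf w v.length = u.length <;> simp [h, attPiece_eq_attOf]

/-- `|selPiece z| ≤ |unN (fstF (fstF z))|` on every input. -/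
theorem length_selPiece_le (z : List Bool) : (selPiece z).length ≤ (unN (fstF (fstF z))).length := by
  unfold selPiece
  rcases eqPairFn_eq_or (fanoutFn (rankPiece ∘ inner) (lenBinF ∘ sndF ∘ fstF) z) with h | h
  · rw [iteFn_apply_true (by simpa using h)]
    simp [inner]
  · rw [iteFn_apply_false (by simpa using h)]
    simp

/-- **The dictionary lookup**: on `⟨w, 1ʳ⟩`, `lookupOf w r`. -/
noncomputable def lookupFn : List Bool → List Bool :=
  takeFn ∘ fanoutFn (unN ∘ fstF) (foldCat X X selPiece ∘ fanoutFn id (unG ∘ fstF))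

/-- `lookupFn ∈ FP`. -/
theorem lookupFn_mem_FP : lookupFn ∈ FP :=
  comp_mem_FP takeFn_mem_FP (fanoutFn_mem_FP (comp_mem_FP unN_mem_FP fstF_mem_FP)
    (comp_mem_FP (foldCat_mem_FP X X selPiece_mem_FP)
      (fanoutFn_mem_FP (PolyTimeComputable.id _) (comp_mem_FP unG_mem_FP fstF_mem_FP))))

/-- **Value of `lookupFn` on a pair.** -/
@[simp] theorem lookupFn_boolPair (w u : List Bool) : lookupFn (boolPair w u) = lookupOf w u.length := by
  have hlen : (unG w).length ≤ X.eval (boolPair w u).length := by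
    have := length_unG_le' w
    simp only [eval_X, length_boolPair]; omega
  have h := foldCat_apply (Q := X) (p := X) (f := selPiece) (x := boolPair w u) (u := unG w) hlen
    (fun t _ => (length_selPiece_le _).trans (by
      have := length_unN_le w
      simp only [fstF_boolPair, eval_X, length_boolPair]; omega))
  simp only [lookupFn, Function.comp_apply, fanoutFn_apply, id, fstF_boolPair, h, takeFn_boolPair]
  unfold lookupOf lookupFam
  congr 1
  refine ccat_congr fun j _ => ?_
  rw [selPiece_apply]; simp [ones, rankOf]

/-- The dictionary piece: on `⟨w, 1ʳ⟩`, the frame `⟨lookupOf w r, ε⟩`. -/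
noncomputable def dictPiece : List Bool → List Bool := fanoutFn lookupFn (fun _ => [])

/-- `dictPiece ∈ FP`. -/
theorem dictPiece_mem_FP : dictPiece ∈ FP := fanoutFn_mem_FP lookupFn_mem_FP (const_mem_FP _)

/-- Value of `dictPiece` on a pair. -/
@[simp] theorem dictPiece_boolPair (w u : List Bool) : dictPiece (boolPair w u) = boolPair (lookupOf w u.length) [] := by
  simp [dictPiece]

/-- **The attachment dictionary** `dictFn w = encList [lookupOf w r | r < g]`. -/
noncomputable def dictFn : List Bool → List Bool := foldCat (2 * X + 2) X dictPiece ∘ fanoutFn id unG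

/-- `dictFn ∈ FP`. -/
theorem dictFn_mem_FP : dictFn ∈ FP :=
  comp_mem_FP (foldCat_mem_FP _ X dictPiece_mem_FP) (fanoutFn_mem_FP (PolyTimeComputable.id _) unG_mem_FP)

/-- **Value of `dictFn` on every input.** -/
theorem dictFn_apply (w : List Bool) : dictFn w = encList ((List.range (unG w).length).map (lookupOf w)) := by
  have h := foldCat_apply (Q := 2 * X + 2) (p := X) (f := dictPiece) (x := w) (u := unG w)
    (by simpa using length_unG_le' w) (fun t _ => by
      rw [dictPiece_boolPair, length_boolPair]
      have := length_lookupOf_le w (ones t).length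
      have := length_unN_le w
      simp only [List.length_nil, add_zero, eval_add, eval_mul, eval_ofNat, eval_X]; omega)
  simp only [dictFn, Function.comp_apply, fanoutFn_apply, id, h]
  rw [← ccat_frame_eq_encList]
  refine ccat_congr fun t _ => ?_
  rw [dictPiece_boolPair]; simp [ones]

/-! ### The extracted coloured free graph and the invariant -/

/-- **The extraction** `extractFn w = ⟨⟨encodeNat g, freeFn w⟩, ⟨1ᵍ, coloursFn w⟩⟩`: on a graph code,
the code `⟨encodingGraph.encode ⟨g, free graph⟩, (encodingFinVec encodingNatBool g).encode rank⟩` of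
the rank-coloured graph induced on the free vertices. -/
noncomputable def extractFn : List Bool → List Bool :=
  fanoutFn (fanoutFn (lenBinF ∘ unG) freeFn) (fanoutFn unG coloursFn)

/-- `extractFn ∈ FP`. -/
theorem extractFn_mem_FP : extractFn ∈ FP :=
  fanoutFn_mem_FP (fanoutFn_mem_FP (comp_mem_FP lenBinF_mem_FP unG_mem_FP) freeFn_mem_FP)
    (fanoutFn_mem_FP unG_mem_FP coloursFn_mem_FP)

/-- Value of `extractFn`. -/
theorem extractFn_apply (w : List Bool) :
    extractFn w = boolPair (boolPair (encodeNat (unG w).length) (freeFn w)) (boolPair (unG w) (coloursFn w)) := by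
  simp [extractFn]

/-- **The intermediate length is poly-logarithmic**: `|extractFn w| ≤ (3 (⌊log₂ |w|⌋ + 1))²` on every input. -/
theorem length_extractFn_le (w : List Bool) : (extractFn w).length ≤ (3 * (Nat.log 2 w.length + 1)) ^ 2 := by
  rw [extractFn_apply, length_boolPair, length_boolPair, length_boolPair]
  have h1 := length_freeFn_le w
  have h2 := length_coloursFn_le w
  have h3 := length_encodeNat_le_self (unG w).length
  have h4 := length_unG_le w
  set g := (unG w).length
  set L := Nat.log 2 w.length
  have h5 : g * g ≤ L * L := Nat.mul_le_mul h4 h4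
  have h6 : g * (2 * g + 2) ≤ L * (2 * L + 2) := Nat.mul_le_mul h4 (by omega)
  nlinarith

/-- **The invariant** `invFn can w = ⟨⟨fixedFn w, dictFn w⟩, can (extractFn w)⟩`. -/
noncomputable def invFn (can : List Bool → List Bool) : List Bool → List Bool :=
  fanoutFn (fanoutFn fixedFn dictFn) (can ∘ extractFn)

/-- Value of `invFn`. -/
theorem invFn_apply (can : List Bool → List Bool) (w : List Bool) :
    invFn can w = boolPair (boolPair (fixedFn w) (dictFn w)) (can (extractFn w)) := by
  simp [invFn]

/-! ### Composition with a `2^{O(√N)}`-time map at poly-logarithmic length -/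

/-- The time bound `N ↦ a 2^{c √N} + a` is monotone. -/
theorem monotone_expSqrt (c a : ℕ) : Monotone fun N : ℕ => a * 2 ^ (c * Nat.sqrt N) + a := by
  intro x y hxy
  have : 2 ^ (c * Nat.sqrt x) ≤ 2 ^ (c * Nat.sqrt y) :=
    Nat.pow_le_pow_right (by norm_num) (Nat.mul_le_mul_left c (Nat.sqrt_le_sqrt hxy))
  exact Nat.add_le_add_right (Nat.mul_le_mul_left a this) a

/-- **A `2^{O(√N)}`-time map after a poly-time map of squared-logarithmic output length is poly-time**:
if `can ∈ FTIME (N ↦ 2^{c√N})`, `f ∈ FP` and `|f w| ≤ (C log₂|w| + C)²`, then `can ∘ f ∈ FP` — run `f`,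
then `can` on its output, for `a 2^{c (C log₂|w| + C)} + a ≤ a 2^{cC} (|w|+1)^{cC} + a` more steps
(`TimeComputable.comp_holds`, `Nat.sqrt_eq'`). -/
theorem comp_mem_FP_of_FTIME_sqrt {can f : List Bool → List Bool} {c : ℕ}
    (hcan : can ∈ FTIME fun N => 2 ^ (c * Nat.sqrt N)) (hf : f ∈ FP) (C : ℕ)
    (hlen : ∀ w, (f w).length ≤ (C * Nat.log 2 w.length + C) ^ 2) : can ∘ f ∈ FP := by
  obtain ⟨a, ha⟩ := hcan
  obtain ⟨p, hp⟩ := hf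
  obtain ⟨D, hD⟩ := TimeComputable.comp_holds ha hp (monotone_expSqrt c a)
    (s := fun n => (C * Nat.log 2 n + C) ^ 2) hlen
  set P : Polynomial ℕ := Polynomial.C D * (p + (Polynomial.C (a * 2 ^ (c * C)) * (X + 1) ^ (c * C) +
    Polynomial.C a) + (Polynomial.C C * X + Polynomial.C C) ^ 2) + Polynomial.C D with hP
  refine ⟨P, hD.mono fun n => ?_⟩
  have h1 : a * 2 ^ (c * Nat.sqrt ((C * Nat.log 2 n + C) ^ 2)) ≤ a * 2 ^ (c * C) * (n + 1) ^ (c * C) := by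
    rw [Nat.sqrt_eq', Nat.mul_assoc]
    exact Nat.mul_le_mul_left a (two_pow_mul_log_le c C n)
  have h2 : C * Nat.log 2 n ≤ C * n := Nat.mul_le_mul_left C (Nat.log_le_self 2 n)
  have h2' : (C * Nat.log 2 n + C) ^ 2 ≤ (C * n + C) ^ 2 := Nat.pow_le_pow_left (by omega) 2
  simp only [hP, eval_add, eval_mul, eval_C, eval_X, eval_pow, eval_one]
  have h3 : p.eval n + (a * 2 ^ (c * Nat.sqrt ((C * Nat.log 2 n + C) ^ 2)) + a) + (C * Nat.log 2 n + C) ^ 2 ≤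
      p.eval n + (a * 2 ^ (c * C) * (n + 1) ^ (c * C) + a) + (C * n + C) ^ 2 := by omega
  exact Nat.add_le_add_right (Nat.mul_le_mul_left D h3) D

/-- **`invFn can ∈ FP`** for `can ∈ FTIME (N ↦ 2^{c√N})`. -/
theorem invFn_mem_FP {can : List Bool → List Bool} {c : ℕ} (hcan : can ∈ FTIME fun N => 2 ^ (c * Nat.sqrt N)) :
    invFn can ∈ FP :=
  fanoutFn_mem_FP (fanoutFn_mem_FP fixedFn_mem_FP dictFn_mem_FP)
    (comp_mem_FP_of_FTIME_sqrt hcan extractFn_mem_FP 3 fun w =>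
      (length_extractFn_le w).trans (by rw [Nat.mul_add, Nat.mul_one]))

end Summit.PneNP.PneNP.Theorems.CompleteInvariant

namespace Summit.PneNP.PneNP.Theorems

open Literature.Computability.Complexity CompleteInvariant

/-- **Registered sub-goal of S1b (`stub_completeInvariantFP_invFn_mem_FP`)**: the invariant is in `FP`
for every `2^{O(√N)}`-time canoniser (brick file `SymmetryBudgetWindowBarrierExtractBricks2`). -/
theorem stub_completeInvariantFP_invFn_mem_FP : ∀ (c : ℕ) (can : List Bool → List Bool), can ∈ FTIME (fun N => 2 ^ (c * Nat.sqrt N)) → invFn can ∈ FP :=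
  fun _ _ hcan => invFn_mem_FP hcan

end Summit.PneNP.PneNP.Theorems
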